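import Mathlib.Analysis.Convolution
import Mathlib.Analysis.Calculus.Deriv.Basic
import Literature.MathematicalPhysics.QuantumManyBody.PeriodicBoseGas
import HarnessLib

/-!
# Lieb's simple equation for the Bose gas (Carlen–Jauslin–Lieb): the objects

Topic: `Literature/MathematicalPhysics/QuantumManyBody`. Definition request
`defn-LiebSimpleEquation` (route AtomisticToContinuum/BoseEinsteinCondensation/BECAmplitudeHierarchy,
crux `HierarchyContraction`, stmt-AtomisticToContinuum-7146): the objects of Lieb's 1963
"simplified approach" as analysed by Carlen–Jauslin–Lieb, CJL-I = Pure Appl. Anal. 2 (2020)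
(arXiv:1912.04987) and CJL-II = SIAM J. Math. Anal. 53 (2021) (arXiv:2010.13882). This file has
DEFINITIONS ONLY (real bodies, junk values documented, a few proved API lemmas); the theorems of
CJL-I/II are vendored as named facts in `LiebSimpleEquationFacts.lean`.

## The objects, as printed, and their Lean rendering (namespace `LiebSimpleEquation`)

All on `ℝ³` (`BoseGas.Space`), for a potential `𝒱 : ℝ³ → ℝ` (CJL: `𝒱 ≥ 0`, `L¹ ∩ Lᵖ`), in the
units of CJL (`m = ħ = 1`, `H_N = −½∑Δᵢ + ∑𝒱(xᵢ − xⱼ)`, CJL-II (1.2)); see `halfProfile` for the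
map to the tree's `ħ = 2m = 1` Bose gas (`e_tree(w) = 2 e_CJL(½w)`, same `ρ`, same `a`).

* The simple equation and the energy constraint (CJL-I (1.1)–(1.2), CJL-II (1.1)):
  `(−Δ + 4e + 𝒱)u = 𝒱 + 2eρ u∗u`, `e = (ρ/2)∫(1 − u)𝒱`, physical class `u ∈ L¹`, `0 ≤ u ≤ 1`
  (CJL-I (1.5)). We use CJL's own mild form (1.10), `u = Y_{4e} ∗ (𝒱(1 − u) + 2eρ u∗u)` with the
  Yukawa potential `Y_{4e}(x) = e^{−2√e|x|}/(4π|x|)` ((1.7)–(1.9)), which for integrable `u` with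
  (1.5) is equivalent to (1.1) with `u ∈ W^{2,p}` (CJL-I, after (1.16)): `yukawa`, `conv`,
  `IsMildSolution`, `EnergyConstraint`, **`IsSolution 𝒱 ρ e u`**.
* The density function `ρ(e)` of CJL-I Theorem 1 and the energy `e(ρ)`: **`densityFn 𝒱 e`** :=
  `sSup {ρ | a solution exists at (ρ, e)}` (a singleton by Theorem 1; `densityFn_eq_of_unique` in
  the facts file), **`energyFn 𝒱 ρ`** := least `e > 0` admitting a solution at density `ρ`
  (`= e(ρ)` wherever `ρ(·)` is invertible, CJL-II Theorem 3).
* The pinned system (CJL-II (1.20)) `(−Δ + 2μ + 4e_μ)u_μ = (1 − u_μ)𝒱 + 2ρe_μ u_μ∗u_μ`,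
  `e_μ = (ρ/2)∫(1 − u_μ)𝒱`: **`IsPinnedSolution 𝒱 ρ μ e u`** (mild form with `Y_{4e+2μ}`; at
  `μ = 0` it is `IsSolution`, `isPinnedSolution_zero_iff`), **`pinnedEnergy 𝒱 ρ μ = e_μ`** (least
  admissible `e > 0`), and CJL's non-condensed fraction **`eta 𝒱 ρ := ∂_μ e_μ|_{μ=0}`** ((1.21),
  Mathlib `deriv`).
* The operators **`𝔎_e = (−Δ + 𝒱 + 4e(1 − C_{ρu}))⁻¹`** (CJL-II (1.7)) and
  **`𝔜_e = (−Δ + 4e(1 − C_{ρu}))⁻¹`** ((1.31)): `IsKeSolution` / `IsYeSolution` (mild equations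
  `w = Y_{4e} ∗ (ψ − 𝒱w + 4eρ u∗w)`, resp. without `𝒱`, for `w ∈ L²`) and the applications
  **`keApply 𝒱 ρ e u ψ = 𝔎_e ψ`**, **`yeApply ρ e u ψ = 𝔜_e ψ`** by `Classical.epsilon` (the
  unique `L²` solution when it exists — `𝔎_e : L¹ → L²` is bounded, CJL-II Lemma 1.10/(1.33), and
  injective on `L²` by positivity of `−Δ`, `𝒱`, `4e(I − C_{ρu})`, (1.29); junk otherwise).
* The closed formula of CJL-II Theorem 6 (1.25), **`etaFormula 𝒱 ρ e u`** :=
  `ρ∫𝒱𝔎_e u / (1 − ρ∫𝒱𝔎_e(2u − ρu∗u))`.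
* The zero-energy scattering solution and CJL's scattering length (CJL-I (3.7)–(3.11)):
  **`IsScatteringSolution 𝒱 φ`** (`φ = Y_0 ∗ (𝒱(1 − φ))`, `0 ≤ φ ≤ 1`) and
  **`scatteringLengthOf 𝒱 φ = (4π)⁻¹∫𝒱(1 − φ)`** (Lemma 3.1, (3.11)).
* Units bridge **`halfProfile w = ½ w(|·|)`** for an LSSY profile `w : ℝ → ℝ≥0∞`.

Not here: Lieb's "big"/"full" equation (Jauslin 2025, Def. 4.3; CJL-I (5.?)), the momentum
distribution (CJL-II Theorem 7), `Lᵖ → L^q` theory of `𝔎_e`, any existence proof.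

## Design choices and wording risks

* Mild (Yukawa) forms throughout instead of unbounded-operator inverses: this is how CJL
  themselves rewrite and solve the equations ((1.10), (1.16); iteration of §2); equalities are
  required at EVERY `x` (solutions are continuous, `W^{2,p} ⊂ C⁰` for `p > 3/2`).
* `densityFn`/`energyFn`/`pinnedEnergy` are `sSup`/`sInf` selections with junk values `0` on
  empty sets; they are THE printed functions exactly where CJL-I Theorem 1 / CJL-II Theorem 3
  give uniqueness. `keApply`, `yeApply` use `Classical.epsilon` (documented junk).
* `eta` is a two-sided derivative at `μ = 0` ("a real parameter `μ`", CJL-II before (1.10)).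
* Nothing here asserts existence: every theorem of CJL is a named fact in the companion file.

## References

* E. A. Carlen, I. Jauslin, E. H. Lieb, *Analysis of a simple equation for the ground state
  energy of the Bose gas*, Pure Appl. Anal. 2 (2020) 659–684, arXiv:1912.04987: (1.1)–(1.2),
  (1.5)–(1.10), (1.13), (1.16), Theorem 1, §3.2 (3.7)–(3.11), Lemma 3.1. [CarlenJauslinLieb2020]
* E. A. Carlen, I. Jauslin, E. H. Lieb, *… II: Monotonicity, convexity, and condensate
  fraction*, SIAM J. Math. Anal. 53 (2021) 5322–5360, arXiv:2010.13882: (1.1)–(1.2), (1.7),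
  (1.20)–(1.21), (1.25), (1.29)–(1.33), §5. [CarlenJauslinLieb2021]
* E. H. Lieb, *Simplified approach to the ground-state energy of an imperfect Bose gas*, Phys.
  Rev. 130 (1963) 2518–2528. [Lieb1963]
* I. Jauslin, *An introduction to Lieb's simplified approach to the Bose gas*, 2025, §4
  (Defs. 4.3–4.4). [Jauslin2025]
-/

noncomputable section

open MeasureTheory Filter Set
open scoped ENNReal Topology

namespace Literature.MathematicalPhysics.QuantumManyBody

namespace LiebSimpleEquation

open BoseGas (Space)

/-! ## Convolution, the Yukawa potential, mild solutions -/

/-- Convolution of real functions on `ℝ³`, `(f ∗ g)(x) = ∫ f(y) g(x - y) dy` (Mathlib's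
`MeasureTheory.convolution` for the multiplication pairing and Lebesgue measure; the `u ∗ u` of
CJL (1.1): "`u∗u(x) := ∫ u(x−y)u(y) dy`"). [cite: CarlenJauslinLieb2020, (1.1)] -/
def conv (f g : Space → ℝ) : Space → ℝ :=
  MeasureTheory.convolution f g (ContinuousLinearMap.mul ℝ ℝ) volume

/-- `(f ∗ g)(x) = ∫ f(y) g(x - y) dy`. [folklore] -/
theorem conv_apply (f g : Space → ℝ) (x : Space) : conv f g x = ∫ y, f y * g (x - y) := rfl

/-- The **Yukawa potential** `Y_c(x) = e^{-√c |x|} / (4π|x|)` on `ℝ³`, the kernel of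
`G = (−Δ + c)⁻¹` for `c > 0` (CJL-I (1.8)–(1.9): `G_e := [−Δ + 4e]⁻¹`, `G_e f = Y_{4e} ∗ f`,
`Y_{4e}(x) = e^{−2√e|x|}/(4π|x|)`); for `c = 0` the Newton kernel `1/(4π|x|)` of the scattering
equation (CJL-I, proof of Lemma 3.1: `G(x) = 1/(4π|x|)`). Junk value `0` at `x = 0`.
[cite: CarlenJauslinLieb2020, (1.8)–(1.9)] -/
def yukawa (c : ℝ) (x : Space) : ℝ :=
  Real.exp (-(Real.sqrt c * ‖x‖)) / (4 * Real.pi * ‖x‖)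

/-- `Y_c ≥ 0`. [cite: CarlenJauslinLieb2020, (1.8)–(1.9)] -/
theorem yukawa_nonneg (c : ℝ) (x : Space) : 0 ≤ yukawa c x := by
  unfold yukawa; positivity

/-- `Y_0(x) = 1/(4π|x|)`, the Newton kernel. [cite: CarlenJauslinLieb2020, §3.2 (proof of Lemma 3.1)] -/
theorem yukawa_zero (x : Space) : yukawa 0 x = (4 * Real.pi * ‖x‖)⁻¹ := by
  simp [yukawa]

/-- **Mild form** of `(−Δ + c) u = (1 − u)𝒱 + 2eρ u∗u` on `ℝ³`:
`u = Y_c ∗ ((1 − u)𝒱 + 2eρ u∗u)` pointwise (CJL-I (1.10): "Equation (1.1) can be rewritten as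
`u = Y_{4e} ∗ (𝒱(1 − u)) + 2eρ Y_{4e} ∗ u ∗ u`", the case `c = 4e`; the pinned system of CJL-II
(1.20) is the case `c = 4e_μ + 2μ`). [cite: CarlenJauslinLieb2020, (1.10)] -/
def IsMildSolution (𝒱 : Space → ℝ) (ρ e c : ℝ) (u : Space → ℝ) : Prop :=
  ∀ x, u x = conv (yukawa c) (fun y => (1 - u y) * 𝒱 y + 2 * e * ρ * conv u u y) x

/-- **The energy constraint** `e = (ρ/2) ∫ (1 − u(x)) 𝒱(x) dx` (CJL-I (1.2); CJL-II (1.1):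
`2e/ρ = ∫ (1 − u)v`). [cite: CarlenJauslinLieb2020, (1.2)] -/
def EnergyConstraint (𝒱 : Space → ℝ) (ρ e : ℝ) (u : Space → ℝ) : Prop :=
  e = ρ / 2 * ∫ x, (1 - u x) * 𝒱 x

/-! ## Solutions of the simple equation; the density function `ρ(e)` and energy `e(ρ)` -/

/-- **A (physical) solution of Lieb's simple equation** at density `ρ` and energy `e` for the
potential `𝒱` on `ℝ³` (CJL-I (1.1)–(1.2) with the constraint (1.6); units of CJL: `m = ħ = 1`,
kinetic energy `−½Δ` per particle): an integrable `u : ℝ³ → ℝ` with `0 ≤ u ≤ 1` solving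
`(−Δ + 4e + 𝒱)u = 𝒱 + 2eρ u∗u` in the mild form (1.10) and `e = (ρ/2)∫(1 − u)𝒱`. This is the
class in which CJL-I Theorem 1 asserts existence and uniqueness.
[cite: CarlenJauslinLieb2020, (1.1)–(1.2) and (1.6)] -/
structure IsSolution (𝒱 : Space → ℝ) (ρ e : ℝ) (u : Space → ℝ) : Prop where
  integrable : Integrable u
  nonneg : ∀ x, 0 ≤ u x
  le_one : ∀ x, u x ≤ 1
  mild : IsMildSolution 𝒱 ρ e (4 * e) u
  energy : EnergyConstraint 𝒱 ρ e u

/-- Degenerate sanity check of the definitions: for `𝒱 = 0` and `e = 0`, `u = 0` is a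
solution at every density (all terms vanish). (CJL exclude this case: `𝒱 ≠ 0`, `e > 0`.) [folklore] -/
theorem isSolution_zero (ρ : ℝ) : IsSolution 0 ρ 0 0 where
  integrable := integrable_zero _ _ _
  nonneg := fun _ => le_rfl
  le_one := fun _ => zero_le_one
  mild := fun x => by
    show (0 : ℝ) = conv (yukawa (4 * 0)) (fun y => (1 - (0 : Space → ℝ) y) * (0 : Space → ℝ) y +
      2 * 0 * ρ * conv 0 0 y) x
    simp only [Pi.zero_apply, mul_zero, zero_mul, add_zero]
    rw [show (fun _ : Space => (0 : ℝ)) = 0 from rfl, conv, MeasureTheory.convolution_zero]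
    rfl
  energy := by simp [EnergyConstraint]

/-- The set of densities `ρ` for which the system has a solution at energy `e` (a singleton
`{ρ(e)}` by CJL-I Theorem 1). [cite: CarlenJauslinLieb2020, Theorem 1] -/
def solutionDensities (𝒱 : Space → ℝ) (e : ℝ) : Set ℝ :=
  {ρ | ∃ u, IsSolution 𝒱 ρ e u}

/-- **CJL's density function `ρ(e)`** (CJL-I Theorem 1: "there is a constructively defined
continuous function `ρ(e)` on `(0,∞)` … such that for `ρ = ρ(e)` the system has a unique
integrable solution … if `ρ ≠ ρ(e)` … no integrable solution"): rendered as the supremum of the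
set of densities admitting a solution at energy `e`, which by Theorem 1 is the singleton `{ρ(e)}`
(junk `sSup` value otherwise). [cite: CarlenJauslinLieb2020, Theorem 1] -/
def densityFn (𝒱 : Space → ℝ) (e : ℝ) : ℝ :=
  sSup (solutionDensities 𝒱 e)

/-! ## The pinned system, `e_μ`, and the non-condensed fraction `η` -/

/-- **A solution of the pinned ("`μ`-modified") simple equation** (CJL-II (1.20)):
`(−Δ + 2μ + 4e) u = (1 − u)𝒱 + 2ρe u∗u`, `e = (ρ/2)∫(1 − u)𝒱`, in the mild form with the
Yukawa kernel of mass `4e + 2μ`, in the same physical class (integrable, `0 ≤ u ≤ 1`; the class is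
our choice — CJL-II leave existence for the pinned system "to the reader", §5). At `μ = 0` this is
`IsSolution` (`isPinnedSolution_zero_iff`). [cite: CarlenJauslinLieb2021, (1.20)] -/
structure IsPinnedSolution (𝒱 : Space → ℝ) (ρ μ e : ℝ) (u : Space → ℝ) : Prop where
  integrable : Integrable u
  nonneg : ∀ x, 0 ≤ u x
  le_one : ∀ x, u x ≤ 1
  mild : IsMildSolution 𝒱 ρ e (4 * e + 2 * μ) u
  energy : EnergyConstraint 𝒱 ρ e u

/-- The pinned system at `μ = 0` is the simple equation. [cite: CarlenJauslinLieb2021, §5 ("`e₀ = e`, `u = u₀`")] -/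
theorem isPinnedSolution_zero_iff {𝒱 : Space → ℝ} {ρ e : ℝ} {u : Space → ℝ} :
    IsPinnedSolution 𝒱 ρ 0 e u ↔ IsSolution 𝒱 ρ e u := by
  constructor
  · rintro ⟨h1, h2, h3, h4, h5⟩
    exact ⟨h1, h2, h3, by simpa using h4, h5⟩
  · rintro ⟨h1, h2, h3, h4, h5⟩
    exact ⟨h1, h2, h3, by simpa using h4, h5⟩

/-- **The pinned energy `e_μ` at density `ρ`** (CJL-II (1.20)–(1.21)): the least energy `e > 0`
for which the pinned system has a solution at density `ρ` and pinning `μ` (junk `sInf ∅ = 0` if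
none; for `μ = 0` and `ρ` in the range of `ρ(·)` this is an energy `e` with `ρ(e) = ρ`, the least
one if `ρ(·)` is not injective). [cite: CarlenJauslinLieb2021, (1.20)–(1.21)] -/
def pinnedEnergy (𝒱 : Space → ℝ) (ρ μ : ℝ) : ℝ :=
  sInf {e | 0 < e ∧ ∃ u, IsPinnedSolution 𝒱 ρ μ e u}

/-- **The energy per particle `e(ρ)`** predicted by the simple equation ("One would like to fix a
value `ρ` for the density, and then one expects … a unique value of `e = e(ρ)`", CJL-I §1; CJL-II:
`ρ ↦ e(ρ)` is well defined where `ρ(·)` is invertible, Theorem 3): `pinnedEnergy` at `μ = 0`, i.e.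
the least `e > 0` admitting a solution at density `ρ`. [cite: CarlenJauslinLieb2021, Theorem 3] -/
def energyFn (𝒱 : Space → ℝ) (ρ : ℝ) : ℝ :=
  pinnedEnergy 𝒱 ρ 0

/-- `e(ρ) = e_0(ρ)`. [folklore] -/
theorem energyFn_eq (𝒱 : Space → ℝ) (ρ : ℝ) : energyFn 𝒱 ρ = pinnedEnergy 𝒱 ρ 0 := rfl

/-- **CJL's non-condensed fraction** `η := ∂_μ e_μ|_{μ=0}` (CJL-II (1.21); "we always use `η` to
mean the quantity defined in (1.21), and not the true uncondensed fraction"): the derivative at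
`0` of `μ ↦ e_μ` (`pinnedEnergy`; Mathlib `deriv`, junk `0` if not differentiable).
[cite: CarlenJauslinLieb2021, (1.21)] -/
def eta (𝒱 : Space → ℝ) (ρ : ℝ) : ℝ :=
  deriv (fun μ => pinnedEnergy 𝒱 ρ μ) 0

/-! ## The operators `𝔎_e` and `𝔜_e` and the closed formula for `η` -/

/-- `w = 𝔎_e ψ` for **`𝔎_e := (−Δ + 𝒱 + 4e(1 − C_{ρu}))⁻¹`** (CJL-II (1.7), `C_{ρu}` =
convolution by `ρu`), rendered as the mild equation `w = Y_{4e} ∗ (ψ − 𝒱w + 4eρ u∗w)` for a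
square-integrable `w` (`𝔎_e` maps `L¹` to `L²`, CJL-II Lemma 1.10 (1.33); in `L²` the solution
is unique since `−Δ ≥ 0`, `𝒱 ≥ 0`, `4e(I − C_{ρu}) ≥ 0`, (1.29)). [cite: CarlenJauslinLieb2021, (1.7)] -/
def IsKeSolution (𝒱 : Space → ℝ) (ρ e : ℝ) (u ψ w : Space → ℝ) : Prop :=
  MemLp w 2 ∧ ∀ x, w x = conv (yukawa (4 * e)) (fun y => ψ y - 𝒱 y * w y + 4 * e * ρ * conv u w y) x

/-- **`𝔎_e ψ`** (CJL-II (1.7)): a square-integrable mild solution of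
`(−Δ + 𝒱 + 4e(1 − ρ u∗))w = ψ` chosen by `Classical.epsilon` (THE solution when it exists, by
uniqueness in `L²`; junk otherwise). [cite: CarlenJauslinLieb2021, (1.7)] -/
def keApply (𝒱 : Space → ℝ) (ρ e : ℝ) (u ψ : Space → ℝ) : Space → ℝ :=
  Classical.epsilon (IsKeSolution 𝒱 ρ e u ψ)

/-- `w = 𝔜_e ψ` for **`𝔜_e := (−Δ + 4e(1 − C_{ρu}))⁻¹`** (CJL-II (1.31)), the convolution
operator with `𝔜̂_e(k) = (k² + 4e(1 − ρû(k)))⁻¹`: mild form `w = Y_{4e} ∗ (ψ + 4eρ u∗w)`,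
`w ∈ L²`. [cite: CarlenJauslinLieb2021, (1.31)] -/
def IsYeSolution (ρ e : ℝ) (u ψ w : Space → ℝ) : Prop :=
  MemLp w 2 ∧ ∀ x, w x = conv (yukawa (4 * e)) (fun y => ψ y + 4 * e * ρ * conv u w y) x

/-- **`𝔜_e ψ`** (CJL-II (1.31)), by choice as for `keApply` (no `𝒱`: `𝔜_e` involves only `e`,
`ρ`, `u`). [cite: CarlenJauslinLieb2021, (1.31)] -/
def yeApply (ρ e : ℝ) (u ψ : Space → ℝ) : Space → ℝ :=
  Classical.epsilon (IsYeSolution ρ e u ψ)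

/-- `𝔜_e` is the `𝒱 = 0` case of `𝔎_e`. [cite: CarlenJauslinLieb2021, (1.31)–(1.32)] -/
theorem isYeSolution_iff_isKeSolution_zero {ρ e : ℝ} {u ψ w : Space → ℝ} :
    IsYeSolution ρ e u ψ w ↔ IsKeSolution 0 ρ e u ψ w := by
  simp [IsYeSolution, IsKeSolution]

/-- **The closed formula for `η`** (the right-hand side of CJL-II Theorem 6, (1.25)):
`ρ ∫ 𝒱 𝔎_e u / (1 − ρ ∫ 𝒱 𝔎_e(2u − ρ u∗u))`, for the solution `u` at `(ρ, e)`.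
[cite: CarlenJauslinLieb2021, Theorem 6 (1.25)] -/
def etaFormula (𝒱 : Space → ℝ) (ρ e : ℝ) (u : Space → ℝ) : ℝ :=
  (ρ * ∫ x, 𝒱 x * keApply 𝒱 ρ e u u x) /
    (1 - ρ * ∫ x, 𝒱 x * keApply 𝒱 ρ e u (fun y => 2 * u y - ρ * conv u u y) x)

/-! ## The zero-energy scattering solution and CJL's scattering length -/

/-- **The zero-energy scattering solution** `φ` of `𝒱` (CJL-I (3.7)–(3.8):
`−Δφ = (1 − φ)𝒱`, `φ → 0` at infinity, `φ = lim_{e→0} K_e 𝒱`, `0 ≤ φ ≤ 1`), rendered by the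
resolvent form used in the proof of Lemma 3.1: `φ = G ∗ (𝒱(1 − φ))`, `G(x) = 1/(4π|x|) = Y_0`,
with `0 ≤ φ ≤ 1`. [cite: CarlenJauslinLieb2020, (3.7)–(3.8)] -/
structure IsScatteringSolution (𝒱 : Space → ℝ) (φ : Space → ℝ) : Prop where
  nonneg : ∀ x, 0 ≤ φ x
  le_one : ∀ x, φ x ≤ 1
  mild : ∀ x, φ x = conv (yukawa 0) (fun y => 𝒱 y * (1 - φ y)) x

/-- **CJL's scattering length** of `𝒱` through its scattering solution `φ`:
`4πa = ∫ 𝒱(x)(1 − φ(x)) dx` (CJL-I Lemma 3.1, (3.11); equal to `lim_{|x|→∞} |x|φ(x)`, (3.10),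
under the localisation hypothesis (3.9)). For `𝒱 = ½ w(|·|)` this is the tree's LSSY scattering
length `BoseGas.scatteringLength w` of the profile `w` (same zero-energy equation
`−Δf + ½ w f = 0`, `f = 1 − φ`; LSSY App. C) — an identification recorded, not proved, here.
[cite: CarlenJauslinLieb2020, Lemma 3.1 (3.11)] -/
def scatteringLengthOf (𝒱 : Space → ℝ) (φ : Space → ℝ) : ℝ :=
  (4 * Real.pi)⁻¹ * ∫ x, 𝒱 x * (1 - φ x)

/-! ## Units: from an LSSY profile to a CJL potential -/

/-- **The CJL potential of an LSSY radial profile**: `𝒱(x) := ½ w(|x|)` (finite part). CJL write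
`H_N = −½∑Δᵢ + ∑𝒱` (CJL-II (1.2), `m = ħ = 1`) while the tree's Bose gas
(`BoseGas`, `PeriodicBoseGas`) uses `ħ = 2m = 1`, `H = −∑Δᵢ + ∑ w(|xᵢ − xⱼ|)`; since
`−½∑Δ + ∑ ½w = ½(−∑Δ + ∑ w)`, energies correspond as `e_LSSY(w) = 2·e_CJL(½w)`, i.e.
`e_tree(w) = 2 e_CJL(halfProfile w)`, densities and lengths are unchanged, and the scattering
lengths agree: `a_CJL(½w) = a_LSSY(w)` (CJL-I (1.3) `e = 2πρa(…)` vs LHY `4πρa(…)`).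
[cite: CarlenJauslinLieb2021, (1.2)] -/
def halfProfile (w : ℝ → ℝ≥0∞) : Space → ℝ :=
  fun x => (w ‖x‖).toReal / 2

/-- `halfProfile w ≥ 0`. [folklore] -/
theorem halfProfile_nonneg (w : ℝ → ℝ≥0∞) (x : Space) : 0 ≤ halfProfile w x := by
  unfold halfProfile; positivity

/-- `halfProfile w` is radial. [folklore] -/
theorem halfProfile_eq_of_norm_eq (w : ℝ → ℝ≥0∞) {x y : Space} (h : ‖x‖ = ‖y‖) :
    halfProfile w x = halfProfile w y := by
  simp [halfProfile, h]

end LiebSimpleEquation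

end Literature.MathematicalPhysics.QuantumManyBody
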